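import Summits.Schanuel.Schanuel.Theorems.RootDecomp1BRadicalDescent04

/-!
# RootDecomp1BRadicalDescent — lens 4, generations 30–31 «RADICAL DESCENT / STOREY-TWO CELLS» (RadicalDescent.lean g31 47a8f674…, 1887 l) — continuation (RootDecomp1BRadicalDescent05): §E THE CELLS — storey two `X(2)` at `(1, ρ)`, `ρ` ultra-Liouville (mod `hLW`): `four_le_polarDeg_one_ultra`, `kleinPolarSchanuel_body_two_one_ultra`, step instances, `exists_storey_two_cell`; §F THE COLUMN `polarDeg_snoc_ultra` at every storey

(lens-4 g30/g31 `RadicalDescent.lean`, sha256 47a8f674…751d, own farm rc 0 · 0 sorry · axioms std; critic VERDICT STATUS L1626 (d) PORT GO LOW, SOURCE UPDATE L1648;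
port by census-1 gen 15 in six parts `RootDecomp1BRadicalDescent01`–`06` — see the PORT NOTE of part 01; `--supports stmt-Schanuel-24622`; rung 0.)
-/

noncomputable section

open Complex

namespace Summit.Schanuel.Schanuel.Theorems.RootDecomp1BRadicalDescent

/-! ## §E  THE CELLS — storey two at `r = (1, ρ)`, `ρ` ultra-Liouville (mod the LW measure `hLW`)

Base `y = (1, i)` (coordinatewise algebraic, `ℚ`-free), `θ = (e^{y₀}, e^{y₁}) = (e, e^{i})`, `i₀ = 0`, `y₀ = 1`:
the kernel `algebraicIndependent_radical` gives `(e^{ρ}, ρ, e, e^{i})` algebraically independent for every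
ultra-Liouville `ρ > 0`; for `ρ < 0` it is applied to `-ρ` (`e^{-ρ} = (e^{ρ})⁻¹`).  All four numbers lie in the
polar field `F(1, ρ) = ℚ(1, ρ, i, iρ, e, e^{ρ}, e^{i}, e^{iρ})`, hence `t(1, ρ) = polarDeg (1, ρ) ≥ 4 = m + m`
(`m = 2`): the Klein-polar Schanuel inequality AT the `ℚ`-free pair `(1, ρ)` — a STOREY-TWO cell — and with it the
`m = 1 → 2` step instances `(1 | ρ)` of the open analytic items `W0Init / W0 / T0 / SRL` of route 1B. -/

section Cells

open Summit.Schanuel.Schanuel.Theorems.RootDecomp1KHyper (LWMeasure)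
open Summit.Schanuel.Schanuel.Theorems.RootDecomp1BFedFlagCore (KleinIH polarDeg polarField coe_mem_polarField
  exp_coe_mem_polarField exp_coe_mul_I_mem_polarField coe_mul_I_mem_polarField)
open Summit.Schanuel.Schanuel.Theorems.RootDecomp1BTameFlagCore (IsWild LastTame HasSharpHyperplane)
open Summit.Schanuel.Schanuel.Theorems.RootDecomp1BDefectFloorDefs (SharpRelativeLindemannAt TameDefectZeroAt
  WildSharpDefectZeroAt WildSharpDefectZeroInitAt)
open Summit.Schanuel.Schanuel.Theorems.RootDecomp1BDefectFloorCells (natCast_le_trdeg_of_algebraicIndependent)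

/-- ultra-Liouville is symmetric under `ρ ↦ -ρ`. -/
theorem UltraLiouville.neg {ρ : ℝ} (h : UltraLiouville ρ) : UltraLiouville (-ρ) := by
  intro m
  obtain ⟨r, hm, hne, hlt⟩ := h m
  refine ⟨-r, by rwa [Rat.neg_den], fun h' => hne ?_, ?_⟩
  · rw [Rat.cast_neg] at h'
    linarith
  · rw [Rat.neg_den, Rat.cast_neg, show -ρ - -(r : ℝ) = -(ρ - r) by ring, abs_neg]
    exact hlt

/-- `i` is algebraic (`i² = -1`). -/
private theorem isAlgebraic_I_base : IsAlgebraic ℚ Complex.I :=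
  IsAlgebraic.of_pow two_pos (by rw [Complex.I_sq]; exact isAlgebraic_one.neg)

/-- The base `y = (1, i)` is coordinatewise algebraic … -/
theorem isAlgebraic_base (i : Fin 2) : IsAlgebraic ℚ (![(1 : ℂ), Complex.I] i) := by
  fin_cases i
  · exact isAlgebraic_one
  · exact isAlgebraic_I_base

/-- … and `ℚ`-free (real and imaginary parts). -/
theorem linearIndependent_base : LinearIndependent ℚ ![(1 : ℂ), Complex.I] := by
  rw [LinearIndependent.pair_iff]
  intro s t h
  rw [Rat.smul_def, Rat.smul_def, mul_one] at h
  have hre := congrArg Complex.re h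
  have him := congrArg Complex.im h
  simp only [Complex.add_re, Complex.add_im, Complex.mul_re, Complex.mul_im, Complex.ratCast_re,
    Complex.ratCast_im, Complex.I_re, Complex.I_im, Complex.zero_re, Complex.zero_im, mul_zero, mul_one,
    add_zero, zero_add, sub_self] at hre him
  exact ⟨by exact_mod_cast hre, by exact_mod_cast him⟩

/-- `(1, ρ)` is `ℚ`-free for irrational `ρ`. -/
theorem linearIndependent_one_of_irrational {ρ : ℝ} (hρ : Irrational ρ) :
    LinearIndependent ℚ ![(1 : ℝ), ρ] := by
  rw [LinearIndependent.pair_iff]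
  intro s t h
  rw [Rat.smul_def, Rat.smul_def, mul_one] at h
  by_cases ht : t = 0
  · rw [ht, Rat.cast_zero, zero_mul, add_zero] at h
    exact ⟨by exact_mod_cast h, ht⟩
  · exfalso
    refine hρ ⟨-s / t, ?_⟩
    have ht' : ((t : ℚ) : ℝ) ≠ 0 := by exact_mod_cast ht
    push_cast
    field_simp
    linarith

/-- **THE STOREY-TWO TUPLE (`ρ > 0`).** `(e^{ρ}, ρ, e, e^{i})` is algebraically independent over `ℚ` for every
ultra-Liouville `ρ > 0` (mod the Lindemann–Weierstrass measure `hLW`, which feeds the `DExpMeasure` of `(e, e^{i})`). -/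
theorem algebraicIndependent_four_of_pos (hLW : LWMeasure) {ρ : ℝ} (hρ : UltraLiouville ρ) (hρ0 : 0 < ρ) :
    AlgebraicIndependent ℚ
      (Fin.cons (cexp ((ρ : ℂ) * 1)) (Fin.cons (ρ : ℂ) (fun i => cexp (![(1 : ℂ), Complex.I] i))) :
        Fin (2 + 2) → ℂ) :=
  algebraicIndependent_radical (dExpMeasure_exp_of_LW hLW isAlgebraic_base linearIndependent_base) 0
    (by simp) hρ hρ0

/-- **X(2)(1, ρ): `t(1, ρ) ≥ 4 = m + m` (`m = 2`)** for EVERY ultra-Liouville `ρ` (mod `hLW`). -/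
theorem four_le_polarDeg_one_ultra (hLW : LWMeasure) {ρ : ℝ} (hρ : UltraLiouville ρ) :
    ((2 + 2 : ℕ) : Cardinal) ≤ polarDeg ![(1 : ℝ), ρ] := by
  have he : cexp 1 ∈ polarField ![(1 : ℝ), ρ] := by
    simpa using exp_coe_mem_polarField ![(1 : ℝ), ρ] 0
  have hei : cexp Complex.I ∈ polarField ![(1 : ℝ), ρ] := by
    simpa using exp_coe_mul_I_mem_polarField ![(1 : ℝ), ρ] 0
  have hρm : (ρ : ℂ) ∈ polarField ![(1 : ℝ), ρ] := by
    simpa using coe_mem_polarField ![(1 : ℝ), ρ] 1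
  have heρ : cexp (ρ : ℂ) ∈ polarField ![(1 : ℝ), ρ] := by
    simpa using exp_coe_mem_polarField ![(1 : ℝ), ρ] 1
  have hθmem : ∀ i, (fun i => cexp (![(1 : ℂ), Complex.I] i)) i ∈ polarField ![(1 : ℝ), ρ] := by
    intro i
    fin_cases i
    · simpa using he
    · simpa using hei
  have hρne : ρ ≠ 0 := fun h => hρ.irrational ⟨0, by simp [h]⟩
  rcases lt_or_gt_of_ne hρne with hneg | hpos
  · have hai := algebraicIndependent_four_of_pos hLW hρ.neg (neg_pos.2 hneg)
    refine natCast_le_trdeg_of_algebraicIndependent hai fun i => ?_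
    refine Fin.cases ?_ (fun i => ?_) i
    · simp only [Fin.cons_zero, mul_one, Complex.ofReal_neg, Complex.exp_neg]
      exact inv_mem heρ
    · rw [Fin.cons_succ]
      refine Fin.cases ?_ (fun j => ?_) i
      · simp only [Fin.cons_zero, Complex.ofReal_neg]
        exact neg_mem hρm
      · rw [Fin.cons_succ]
        exact hθmem j
  · have hai := algebraicIndependent_four_of_pos hLW hρ hpos
    refine natCast_le_trdeg_of_algebraicIndependent hai fun i => ?_
    refine Fin.cases ?_ (fun i => ?_) i
    · simp only [Fin.cons_zero, mul_one]
      exact heρ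
    · rw [Fin.cons_succ]
      refine Fin.cases ?_ (fun j => ?_) i
      · simp only [Fin.cons_zero]
        exact hρm
      · rw [Fin.cons_succ]
        exact hθmem j

/-- The same in the VERBATIM shape of the body of the 1B crux `KleinPolarSchanuel` (item 24622) at `m = 2`,
`r = (1, ρ)` (`polarDeg` unfolded). -/
theorem kleinPolarSchanuel_body_two_one_ultra (hLW : LWMeasure) {ρ : ℝ} (hρ : UltraLiouville ρ) :
    ((2 + 2 : ℕ) : Cardinal) ≤ Algebra.trdeg ℚ ↥(IntermediateField.adjoin ℚ
      (Set.range (Fin.append (fun j => ((![(1 : ℝ), ρ] j : ℝ) : ℂ)) (fun j => ((![(1 : ℝ), ρ] j : ℝ) : ℂ) * Complex.I)) ∪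
        Set.range (Complex.exp ∘ Fin.append (fun j => ((![(1 : ℝ), ρ] j : ℝ) : ℂ))
          (fun j => ((![(1 : ℝ), ρ] j : ℝ) : ℂ) * Complex.I)))) :=
  four_le_polarDeg_one_ultra hLW hρ

/-- `t(1, ρ) ≥ 3` (the weaker floor, for the SRL step instance). -/
theorem three_le_polarDeg_one_ultra (hLW : LWMeasure) {ρ : ℝ} (hρ : UltraLiouville ρ) :
    ((1 + 1 + 1 : ℕ) : Cardinal) ≤ polarDeg ![(1 : ℝ), ρ] :=
  (Nat.cast_le.2 (by norm_num)).trans (four_le_polarDeg_one_ultra hLW hρ)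

/-- **SRLAt (1 | ρ)** — the sharp relative Lindemann step of item 32406 AT `(1 | ρ)`, `ρ` ultra-Liouville. -/
theorem sharpRelativeLindemannAt_one_ultra (hLW : LWMeasure) {ρ : ℝ} (hρ : UltraLiouville ρ) :
    SharpRelativeLindemannAt 1 ![(1 : ℝ), ρ] :=
  fun _ _ _ => three_le_polarDeg_one_ultra hLW hρ

/-- **T0At (1 | ρ)** — the tame defect-zero step of item 32407 AT `(1 | ρ)` (its conclusion holds outright). -/
theorem tameDefectZeroAt_one_ultra (hLW : LWMeasure) {ρ : ℝ} (hρ : UltraLiouville ρ) :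
    TameDefectZeroAt 1 ![(1 : ℝ), ρ] :=
  fun _ _ _ _ => four_le_polarDeg_one_ultra hLW hρ

/-- **W0At (1 | ρ)** — the wild sharp defect-zero step of item 32408 AT `(1 | ρ)`. -/
theorem wildSharpDefectZeroAt_one_ultra (hLW : LWMeasure) {ρ : ℝ} (hρ : UltraLiouville ρ) :
    WildSharpDefectZeroAt 1 ![(1 : ℝ), ρ] :=
  fun _ _ _ _ _ => four_le_polarDeg_one_ultra hLW hρ

/-- **W0InitAt (1 | ρ)** — the init-form of the wild step AT `(1 | ρ)`. -/
theorem wildSharpDefectZeroInitAt_one_ultra (hLW : LWMeasure) {ρ : ℝ} (hρ : UltraLiouville ρ) :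
    WildSharpDefectZeroInitAt 1 ![(1 : ℝ), ρ] :=
  fun _ _ _ _ _ => four_le_polarDeg_one_ultra hLW hρ

/-- LIVE LINK (route 1K, item 33363 `HyperLiouvilleSchanuel`): its `n = 4` instance at the Klein-polar tuple
`z = (1, ρ, i, iρ)` in the item's verbatim binder shape — the conclusion holds outright (mod `hLW`). -/
theorem hyperLiouvilleSchanuel_instance_one_ultra (hLW : LWMeasure) {ρ : ℝ} (hρ : UltraLiouville ρ) :
    LinearIndependent ℚ (Fin.append (fun j => ((![(1 : ℝ), ρ] j : ℝ) : ℂ))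
        (fun j => ((![(1 : ℝ), ρ] j : ℝ) : ℂ) * Complex.I)) →
      (∀ m : ℕ, ∃ h : Fin (2 + 2) → ℤ, h ≠ 0 ∧
        ‖∑ i, (h i : ℂ) * (Fin.append (fun j => ((![(1 : ℝ), ρ] j : ℝ) : ℂ))
          (fun j => ((![(1 : ℝ), ρ] j : ℝ) : ℂ) * Complex.I)) i‖ < Real.exp (-((1 + ∑ i, (|h i| : ℝ)) ^ m))) →
      ((2 + 2 : ℕ) : Cardinal) ≤ Algebra.trdeg ℚ ↥(IntermediateField.adjoin ℚ
        (Set.range (Fin.append (fun j => ((![(1 : ℝ), ρ] j : ℝ) : ℂ)) (fun j => ((![(1 : ℝ), ρ] j : ℝ) : ℂ) * Complex.I)) ∪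
          Set.range (Complex.exp ∘ Fin.append (fun j => ((![(1 : ℝ), ρ] j : ℝ) : ℂ))
            (fun j => ((![(1 : ℝ), ρ] j : ℝ) : ℂ) * Complex.I)))) :=
  fun _ _ => four_le_polarDeg_one_ultra hLW hρ

/-- **FLAGSHIP.** There is a real `ρ > 0` — irrational, indeed ultra-Liouville, so `(1, ρ)` is `ℚ`-free and
`ρ` is transcendental — with `t(1, ρ) ≥ 4`: the Klein-polar Schanuel inequality decided AT a storey-two pair
(mod the LW measure). -/
theorem exists_storey_two_cell (hLW : LWMeasure) :
    ∃ ρ : ℝ, 0 < ρ ∧ Irrational ρ ∧ LinearIndependent ℚ ![(1 : ℝ), ρ] ∧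
      ((2 + 2 : ℕ) : Cardinal) ≤ polarDeg ![(1 : ℝ), ρ] := by
  obtain ⟨ρ, hρ0, hρ⟩ := exists_pos_ultraLiouville
  exact ⟨ρ, hρ0, hρ.irrational, linearIndependent_one_of_irrational hρ.irrational,
    four_le_polarDeg_one_ultra hLW hρ⟩

/-- … and such `ρ` are DENSE in `ℝ` (a dense `G_δ`, uncountable family of storey-two cells). -/
theorem dense_storey_two_cells (hLW : LWMeasure) :
    Dense {ρ : ℝ | ((2 + 2 : ℕ) : Cardinal) ≤ polarDeg ![(1 : ℝ), ρ]} :=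
  dense_setOf_ultraLiouville.mono fun _ hρ => four_le_polarDeg_one_ultra hLW hρ

end Cells

/-! ## §F  THE COORDINATE COLUMN AT EVERY STOREY — `X(m+1)(β | β_{j₀}·ρ)`

For `β : Fin m → ℝ` coordinatewise algebraic and `ℚ`-free, any index `j₀`, and `ρ` ultra-Liouville, the tuple
`r = (β | β_{j₀} ρ)` (last coordinate an ultra-Liouville multiple of a base coordinate) has
`t(r) = polarDeg r ≥ 2m + 2 = (m+1) + (m+1)`, i.e. the Klein-polar Schanuel inequality holds AT `r` (mod `hLW`):
base `y = (β, iβ)` (`2m` exponentials `θ`), `i₀ ↔ β_{j₀}`, `y₀ = β_{j₀}`, kernel ⟹ `(e^{ρ β_{j₀}}, ρ, e^{β}, e^{iβ})`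
algebraically independent (`2m + 2` elements of `F(r)`; `ρ = r_last / β_{j₀}`).  This UPGRADES the coordinate column
of gen 29 (`floor_snoc_liouville`: the FLOOR `t ≥ 2m+1` = SRL, λ Liouville) to X ITSELF on the ultra-Liouville
sub-column, at every storey; §E is its storey `m = 1`, `β = (1)`. -/

section Column

open Summit.Schanuel.Schanuel.Theorems.RootDecomp1KHyper (LWMeasure transcendental_ofReal_of_liouville)
open Summit.Schanuel.Schanuel.Theorems.RootDecomp1BFedFlagCore (KleinIH polarDeg polarField coe_mem_polarField
  exp_coe_mem_polarField exp_coe_mul_I_mem_polarField coe_mul_I_mem_polarField)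
open Summit.Schanuel.Schanuel.Theorems.RootDecomp1BTameFlagCore (IsWild LastTame HasSharpHyperplane)
open Summit.Schanuel.Schanuel.Theorems.RootDecomp1BDefectFloorDefs (SharpRelativeLindemannAt TameDefectZeroAt
  WildSharpDefectZeroAt WildSharpDefectZeroInitAt)
open Summit.Schanuel.Schanuel.Theorems.RootDecomp1BDefectFloorCells (natCast_le_trdeg_of_algebraicIndependent
  isAlgebraic_of_mem_span_algebraic isAlgebraic_polarExp linearIndependent_polar)

/-- Engine of the column (`σ > 0` ultra-Liouville, memberships supplied): `t(β | u) ≥ 2m + 2`. -/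
theorem polarDeg_snoc_of_pos (hLW : LWMeasure) {m : ℕ} {β : Fin m → ℝ}
    (hβ : ∀ j, IsAlgebraic ℚ ((β j : ℝ) : ℂ)) (hli : LinearIndependent ℚ β) (j₀ : Fin m) {u σ : ℝ}
    (hσ : UltraLiouville σ) (hσ0 : 0 < σ)
    (heσ : cexp ((σ : ℂ) * ((β j₀ : ℝ) : ℂ)) ∈ polarField (Fin.snoc β u : Fin (m + 1) → ℝ))
    (hσm : (σ : ℂ) ∈ polarField (Fin.snoc β u : Fin (m + 1) → ℝ)) :
    ((m + m + 2 : ℕ) : Cardinal) ≤ polarDeg (Fin.snoc β u : Fin (m + 1) → ℝ) := by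
  obtain ⟨y, hy⟩ : ∃ y : Fin (m + m) → ℂ,
      y = Fin.append (fun j => ((β j : ℝ) : ℂ)) (fun j => ((β j : ℝ) : ℂ) * Complex.I) := ⟨_, rfl⟩
  have hθ : DExpMeasure (fun i => cexp (y i)) :=
    dExpMeasure_exp_of_LW hLW (fun i => by rw [hy]; exact isAlgebraic_polarExp β hβ i)
      (by rw [hy]; exact linearIndependent_polar hli)
  have hy0 : cexp ((β j₀ : ℝ) : ℂ) = (fun i => cexp (y i)) (Fin.castAdd m j₀) := by
    show cexp _ = cexp (y (Fin.castAdd m j₀))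
    rw [hy, Fin.append_left]
  have hθmem : ∀ i, (fun i => cexp (y i)) i ∈ polarField (Fin.snoc β u : Fin (m + 1) → ℝ) := by
    intro i
    show cexp (y i) ∈ _
    rw [hy]
    induction i using Fin.addCases with
    | left j =>
        rw [Fin.append_left]
        simpa only [Fin.snoc_castSucc] using
          exp_coe_mem_polarField (Fin.snoc β u : Fin (m + 1) → ℝ) j.castSucc
    | right j =>
        rw [Fin.append_right]
        simpa only [Fin.snoc_castSucc] using
          exp_coe_mul_I_mem_polarField (Fin.snoc β u : Fin (m + 1) → ℝ) j.castSucc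
  have hai := algebraicIndependent_radical hθ (Fin.castAdd m j₀) hy0 hσ hσ0
  refine natCast_le_trdeg_of_algebraicIndependent hai fun i => ?_
  refine Fin.cases ?_ (fun i => ?_) i
  · simp only [Fin.cons_zero]
    exact heσ
  · rw [Fin.cons_succ]
    refine Fin.cases ?_ (fun j => ?_) i
    · simp only [Fin.cons_zero]
      exact hσm
    · rw [Fin.cons_succ]
      exact hθmem j

/-- **THE COLUMN, EVERY STOREY: `t(β | β_{j₀} ρ) ≥ (m+1) + (m+1)`** for `β` real algebraic `ℚ`-free, `ρ`
ultra-Liouville (either sign), mod `hLW`. -/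
theorem polarDeg_snoc_ultra (hLW : LWMeasure) {m : ℕ} {β : Fin m → ℝ}
    (hβ : ∀ j, IsAlgebraic ℚ ((β j : ℝ) : ℂ)) (hli : LinearIndependent ℚ β) (j₀ : Fin m) {ρ : ℝ}
    (hρ : UltraLiouville ρ) :
    ((m + 1 + (m + 1) : ℕ) : Cardinal) ≤ polarDeg (Fin.snoc β (β j₀ * ρ) : Fin (m + 1) → ℝ) := by
  have hb0 : β j₀ ≠ 0 := hli.ne_zero j₀
  have hb0' : ((β j₀ : ℝ) : ℂ) ≠ 0 := by exact_mod_cast hb0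
  have hlast : (((β j₀ * ρ : ℝ)) : ℂ) ∈ polarField (Fin.snoc β (β j₀ * ρ) : Fin (m + 1) → ℝ) := by
    simpa only [Fin.snoc_last] using
      coe_mem_polarField (Fin.snoc β (β j₀ * ρ) : Fin (m + 1) → ℝ) (Fin.last m)
  have helast : cexp (((β j₀ * ρ : ℝ)) : ℂ) ∈ polarField (Fin.snoc β (β j₀ * ρ) : Fin (m + 1) → ℝ) := by
    simpa only [Fin.snoc_last] using
      exp_coe_mem_polarField (Fin.snoc β (β j₀ * ρ) : Fin (m + 1) → ℝ) (Fin.last m)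
  have hbm : ((β j₀ : ℝ) : ℂ) ∈ polarField (Fin.snoc β (β j₀ * ρ) : Fin (m + 1) → ℝ) := by
    simpa only [Fin.snoc_castSucc] using
      coe_mem_polarField (Fin.snoc β (β j₀ * ρ) : Fin (m + 1) → ℝ) j₀.castSucc
  have hρm : (ρ : ℂ) ∈ polarField (Fin.snoc β (β j₀ * ρ) : Fin (m + 1) → ℝ) := by
    have : (ρ : ℂ) = ((β j₀ : ℝ) : ℂ)⁻¹ * (((β j₀ * ρ : ℝ)) : ℂ) := by
      rw [Complex.ofReal_mul, ← mul_assoc, inv_mul_cancel₀ hb0', one_mul]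
    rw [this]
    exact mul_mem (inv_mem hbm) hlast
  have heρ : cexp ((ρ : ℂ) * ((β j₀ : ℝ) : ℂ)) ∈ polarField (Fin.snoc β (β j₀ * ρ) : Fin (m + 1) → ℝ) := by
    have : (ρ : ℂ) * ((β j₀ : ℝ) : ℂ) = (((β j₀ * ρ : ℝ)) : ℂ) := by rw [Complex.ofReal_mul, mul_comm]
    rw [this]
    exact helast
  have hρne : ρ ≠ 0 := fun h => hρ.irrational ⟨0, by simp [h]⟩
  have hmm : ((m + 1 + (m + 1) : ℕ) : Cardinal) = ((m + m + 2 : ℕ) : Cardinal) := by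
    congr 1; omega
  rw [hmm]
  rcases lt_or_gt_of_ne hρne with hneg | hpos
  · refine polarDeg_snoc_of_pos hLW hβ hli j₀ hρ.neg (neg_pos.2 hneg) ?_ ?_
    · rw [Complex.ofReal_neg, neg_mul, Complex.exp_neg]
      exact inv_mem heρ
    · rw [Complex.ofReal_neg]
      exact neg_mem hρm
  · exact polarDeg_snoc_of_pos hLW hβ hli j₀ hρ hpos heρ hρm

/-- The column tuple `(β | β_{j₀} ρ)` is `ℚ`-free (`β_{j₀} ρ` is transcendental, `span_ℚ(β) ⊂ ℚ̄`). -/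
theorem linearIndependent_snoc_mul_ultra {m : ℕ} (β : Fin m → ℝ) (hβ : ∀ j, IsAlgebraic ℚ ((β j : ℝ) : ℂ))
    (hli : LinearIndependent ℚ β) (j₀ : Fin m) {ρ : ℝ} (hρ : UltraLiouville ρ) :
    LinearIndependent ℚ (Fin.snoc β (β j₀ * ρ) : Fin (m + 1) → ℝ) := by
  refine linearIndependent_finSnoc.mpr ⟨hli, fun hmem => ?_⟩
  have halg := isAlgebraic_of_mem_span_algebraic β hβ hmem
  have hb0 : ((β j₀ : ℝ) : ℂ) ≠ 0 := by exact_mod_cast hli.ne_zero j₀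
  have hρalg : IsAlgebraic ℚ ((ρ : ℝ) : ℂ) := by
    have : ((ρ : ℝ) : ℂ) = ((β j₀ : ℝ) : ℂ)⁻¹ * (((β j₀ * ρ : ℝ)) : ℂ) := by
      rw [Complex.ofReal_mul, ← mul_assoc, inv_mul_cancel₀ hb0, one_mul]
    rw [this]
    exact (hβ j₀).inv.mul halg
  exact transcendental_ofReal_of_liouville hρ.liouville hρalg

/-- The column in the VERBATIM shape of the crux body `KleinPolarSchanuel` at `(m+1, (β | β_{j₀} ρ))`. -/
theorem kleinPolarSchanuel_body_column_ultra (hLW : LWMeasure) {m : ℕ} {β : Fin m → ℝ}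
    (hβ : ∀ j, IsAlgebraic ℚ ((β j : ℝ) : ℂ)) (hli : LinearIndependent ℚ β) (j₀ : Fin m) {ρ : ℝ}
    (hρ : UltraLiouville ρ) :
    ((m + 1 + (m + 1) : ℕ) : Cardinal) ≤ Algebra.trdeg ℚ ↥(IntermediateField.adjoin ℚ
      (Set.range (Fin.append (fun j => (((Fin.snoc β (β j₀ * ρ) : Fin (m + 1) → ℝ) j : ℝ) : ℂ))
          (fun j => (((Fin.snoc β (β j₀ * ρ) : Fin (m + 1) → ℝ) j : ℝ) : ℂ) * Complex.I)) ∪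
        Set.range (Complex.exp ∘ Fin.append (fun j => (((Fin.snoc β (β j₀ * ρ) : Fin (m + 1) → ℝ) j : ℝ) : ℂ))
          (fun j => (((Fin.snoc β (β j₀ * ρ) : Fin (m + 1) → ℝ) j : ℝ) : ℂ) * Complex.I)))) :=
  polarDeg_snoc_ultra hLW hβ hli j₀ hρ

/-- **W0At (β | β_{j₀} ρ)** at every storey (item 32408's step AT the column; conclusion holds outright). -/
theorem wildSharpDefectZeroAt_column_ultra (hLW : LWMeasure) {m : ℕ} {β : Fin m → ℝ}
    (hβ : ∀ j, IsAlgebraic ℚ ((β j : ℝ) : ℂ)) (hli : LinearIndependent ℚ β) (j₀ : Fin m) {ρ : ℝ}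
    (hρ : UltraLiouville ρ) : WildSharpDefectZeroAt m (Fin.snoc β (β j₀ * ρ) : Fin (m + 1) → ℝ) :=
  fun _ _ _ _ _ => polarDeg_snoc_ultra hLW hβ hli j₀ hρ

/-- **W0InitAt (β | β_{j₀} ρ)** at every storey. -/
theorem wildSharpDefectZeroInitAt_column_ultra (hLW : LWMeasure) {m : ℕ} {β : Fin m → ℝ}
    (hβ : ∀ j, IsAlgebraic ℚ ((β j : ℝ) : ℂ)) (hli : LinearIndependent ℚ β) (j₀ : Fin m) {ρ : ℝ}
    (hρ : UltraLiouville ρ) : WildSharpDefectZeroInitAt m (Fin.snoc β (β j₀ * ρ) : Fin (m + 1) → ℝ) :=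
  fun _ _ _ _ _ => polarDeg_snoc_ultra hLW hβ hli j₀ hρ

/-- **T0At (β | β_{j₀} ρ)** at every storey (item 32407's step AT the column). -/
theorem tameDefectZeroAt_column_ultra (hLW : LWMeasure) {m : ℕ} {β : Fin m → ℝ}
    (hβ : ∀ j, IsAlgebraic ℚ ((β j : ℝ) : ℂ)) (hli : LinearIndependent ℚ β) (j₀ : Fin m) {ρ : ℝ}
    (hρ : UltraLiouville ρ) : TameDefectZeroAt m (Fin.snoc β (β j₀ * ρ) : Fin (m + 1) → ℝ) :=
  fun _ _ _ _ => polarDeg_snoc_ultra hLW hβ hli j₀ hρ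

/-- **SRLAt (β | β_{j₀} ρ)** at every storey (item 32406's step AT the column; also a case of gen 29's
`floor_snoc_liouville`, recorded for the complete row). -/
theorem sharpRelativeLindemannAt_column_ultra (hLW : LWMeasure) {m : ℕ} {β : Fin m → ℝ}
    (hβ : ∀ j, IsAlgebraic ℚ ((β j : ℝ) : ℂ)) (hli : LinearIndependent ℚ β) (j₀ : Fin m) {ρ : ℝ}
    (hρ : UltraLiouville ρ) : SharpRelativeLindemannAt m (Fin.snoc β (β j₀ * ρ) : Fin (m + 1) → ℝ) :=
  fun _ _ _ => (Nat.cast_le.2 (by omega)).trans (polarDeg_snoc_ultra hLW hβ hli j₀ hρ)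

end Column

end Summit.Schanuel.Schanuel.Theorems.RootDecomp1BRadicalDescent

end
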